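import Mathlib
import Summits.Ventures.PercRepro2.Defs
import Summits.Ventures.PercRepro2.Graph
import Summits.Ventures.PercRepro2.OneColourSwitch
import Summits.Ventures.PercRepro2.RegionHubSign
import Summits.Ventures.PercRepro2.SideSwitch
import Summits.Ventures.PercRepro2.SideSwitchFibre
import Summits.Ventures.PercRepro2.SideSwitchClosed
import Summits.Ventures.PercRepro2.SideSwitchComps
import Summits.Ventures.PercRepro2.TermSwitchDefs
import Summits.Ventures.PercRepro2.TermSwitchFibre
import Summits.Ventures.PercRepro2.TermSwitchMono
import Summits.Ventures.PercRepro2.TermSwitchM9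
import Summits.Ventures.PercRepro2.TermSwitchRestrict
import Summits.Ventures.PercRepro2.M9NoPocketDefs
import Summits.Ventures.PercRepro2.M9NoPocketFibre
import Summits.Ventures.PercRepro2.M9NoPocketCompl
import Summits.Ventures.PercRepro2.M9PocketCubeDefs
import Summits.Ventures.PercRepro2.M9PocketCubeFibre
import Summits.Ventures.PercRepro2.M9Unreached

/-!
# The worlds of `G − d` under the `{r, s}`-switches of `G` (blind cell PercRepro2, p3 g25,
2026-08-28; `proofs/P3-GENERALD.md` §6′) — part A

For an `{r, s}`-representative `ρ` of `G` (`TermSwitch.RepH`: every sided vertex on the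
`Y`-side), a union `unionT T` of components of the sided set of `G` meets the world of `G − d` in
`inWorld T ρ`, a set of sided vertices of `G − d` closed under adjacency inside that world
(`closedIn_inWorld`); an edge of `G` not at `d` with an endpoint in the world of `G − d` touches
`unionT T` iff it touches `inWorld T ρ` (`touches_iff_of_touches_world`).  Hence the component
assignment `assignC T ρ` of `G` acts on the worlds of `G − d` as the side switch of `inWorld`:
`K₂(G − d)` loses it (`K2_endsD_assignC`) and `M₂(G − d)` gains it (`M2_endsD_assignC`).
Part B (`M9PocketRepInvariant`) draws the consequence: the pocket representative `repP` is
invariant under the `{r, s}`-fibration of `G`.  Own work; std axioms.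
-/

namespace Summit.Ventures.PercRepro2

namespace NoPocket

open Finset Classical RegionHub OneColourSwitch SideSwitch TermSwitch

variable {V : Type*} {E : Type*}

section Rep

variable [Fintype V] [DecidableEq V] [Fintype E] [DecidableEq E] {ends : E → Sym2 V}
  {p q r s d : V}

omit [Fintype V] [DecidableEq V] [Fintype E] [DecidableEq E] in
/-- The `Y`-world of `G − d` lies in the `Y`-world of `G`. -/
lemma K2_endsD_subset (ω : Config E) : K2 (endsD ends d) r s ω ⊆ K2 ends r s ω := by
  intro y hy
  rw [mem_K2_iff] at hy ⊢
  rcases hy with hy | hy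
  · exact Or.inl (conn_of_conn_endsD hy)
  · exact Or.inr (conn_of_conn_endsD hy)

omit [Fintype V] [DecidableEq V] [Fintype E] [DecidableEq E] in
/-- The `W`-world of `G − d` lies in the `W`-world of `G`. -/
lemma M2_endsD_subset (ω : Config E) : M2 (endsD ends d) r s ω ⊆ M2 ends r s ω :=
  K2_endsD_subset (ω := OneColourSwitch.compl ω)

omit [DecidableEq V] in
/-- For an `{r, s}`-representative of `G`, the `W`-world of `G − d` is `{r, s}`. -/
lemma eq_r_or_s_of_mem_M2_endsD_of_repH {ρ : Config E} (hG : ρ ∈ RepH ends p q ({r, s} : Set V))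
    {y : V} (hy : y ∈ M2 (endsD ends d) r s ρ) : y = r ∨ y = s := by
  have h := (mem_RepH.1 hG).2 y (M2_endsD_subset ρ hy)
  simpa using h

/-- For an `{r, s}`-representative of `G`, the `W`-side of `G − d` is empty. -/
lemma Bside_endsD_eq_empty_of_repH {ρ : Config E} (hG : ρ ∈ RepH ends p q ({r, s} : Set V)) :
    Bside (endsD ends d) r s ρ = ∅ := by
  refine Finset.eq_empty_of_forall_notMem fun y hy => ?_
  obtain ⟨hyM, hyr, hys⟩ := mem_Bside.1 hy
  have h : y = r ∨ y = s := eq_r_or_s_of_mem_M2_endsD_of_repH (d := d) hG hyM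
  rcases h with h | h
  · exact hyr h
  · exact hys h

omit [Fintype V] [DecidableEq V] [Fintype E] [DecidableEq E] in
/-- Flipping the edges touching the empty set does nothing. -/
lemma flipTouch_empty (ω : Config E) : flipTouch ends (↑(∅ : Finset V) : Set V) ω = ω := by
  funext e
  apply flipTouch_of_notMem
  rintro ⟨x, hx, _, _⟩
  simp at hx

/-- The normalisation of the free edges: `T`-edges to `Y`, pocket edges to `W`. -/
noncomputable def normP (ends : E → Sym2 V) (d r s : V) (ω : Config E) : Config E :=
  flipF (wT ends d r s ω ∪ yPk ends d r s ω) ω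

/-- For an `{r, s}`-representative of `G` the pocket representative is the normalisation of the
free edges. -/
lemma repP_eq_normP_of_repH {ρ : Config E} (hG : ρ ∈ RepH ends p q ({r, s} : Set V)) :
    repP (ends := ends) d r s ρ = normP ends d r s ρ := by
  rw [repP_eq, Bside_endsD_eq_empty_of_repH hG, flipTouch_empty]
  rfl

end Rep

section Switch

variable [Fintype V] [DecidableEq V] [Fintype E] [DecidableEq E] {ends : E → Sym2 V}
  {p q r s d : V}

/-- The part of a union of `{r, s}`-components of `G` inside the world of `G − d`. -/
noncomputable def inWorld (ends : E → Sym2 V) (d r s : V) (T : Finset (Finset V)) (ρ : Config E) :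
    Finset V :=
  (unionT T).filter (fun x => x ∈ A0 (endsD ends d) r s ρ)

omit [Fintype E] [DecidableEq E] in
/-- Membership in `inWorld`. -/
lemma mem_inWorld {T : Finset (Finset V)} {ρ : Config E} {x : V} :
    x ∈ inWorld ends d r s T ρ ↔ x ∈ unionT T ∧ x ∈ A0 (endsD ends d) r s ρ := by
  simp [inWorld]

omit [Fintype E] [DecidableEq E] in
/-- A vertex of the sided set of `G − d` is a sided vertex of `G` (for `H = {r, s}`). -/
lemma mem_A0H_of_mem_A0_endsD {ρ : Config E} {x : V} (hx : x ∈ A0 (endsD ends d) r s ρ) :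
    x ∈ A0H ends ({r, s} : Set V) ρ := by
  rw [mem_A0] at hx
  rw [mem_A0H, KH_pair, MH_pair]
  refine ⟨?_, ?_⟩
  · rcases hx.1 with h | h
    · exact Or.inl (K2_endsD_subset ρ h)
    · exact Or.inr (M2_endsD_subset ρ h)
  · simp only [Set.mem_insert_iff, Set.mem_singleton_iff, not_or]
    exact hx.2

omit [Fintype E] [DecidableEq E] in
/-- A vertex of the sided set of `G − d` is not `d`. -/
lemma ne_d_of_mem_A0_endsD (hr : d ≠ r) (hs : d ≠ s) {ρ : Config E} {x : V}
    (hx : x ∈ A0 (endsD ends d) r s ρ) : x ≠ d := by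
  rintro rfl
  rw [mem_A0] at hx
  rcases hx.1 with h | h
  · exact not_mem_K2_endsD hr hs ρ h
  · exact not_mem_M2_endsD hr hs ρ h

omit [Fintype V] [Fintype E] [DecidableEq E] in
/-- An edge of `G − d` between `x` and `y`, with `x ≠ d`, is an edge of `G` between them. -/
lemma ends_eq_of_endsD_eq {e : E} {x y : V} (hx : x ≠ d) (h : endsD ends d e = s(x, y)) :
    ends e = s(x, y) ∧ d ∉ ends e := by
  by_cases hd : d ∈ ends e
  · rw [endsD_of_mem hd, Sym2.eq_iff] at h
    exfalso
    rcases h with ⟨h1, _⟩ | ⟨_, h2⟩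
    · exact hx h1.symm
    · exact hx h2.symm
  · rw [endsD_of_notMem hd] at h
    exact ⟨h, hd⟩

omit [Fintype E] [DecidableEq E] in
/-- The world of `G − d` contains every vertex joined to `r` or `s` by an edge of `G` not at `d`. -/
lemma mem_A0_endsD_of_edge_rs (hr : d ≠ r) (hs : d ≠ s) {ρ : Config E} {e : E} {x y : V}
    (hends : ends e = s(x, y)) (hnd : d ∉ ends e) (hx : x = r ∨ x = s) (hyr : y ≠ r)
    (hys : y ≠ s) : y ∈ A0 (endsD ends d) r s ρ := by
  have hends' : endsD ends d e = s(x, y) := by rw [endsD_of_notMem hnd]; exact hends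
  rw [mem_A0]
  refine ⟨?_, hyr, hys⟩
  cases he : ρ e with
  | true =>
    left
    rw [mem_K2_iff]
    have hc : Conn (endsD ends d) ρ x y := conn_of_openAdj ⟨e, he, hends'⟩
    rcases hx with rfl | rfl
    · exact Or.inl hc
    · exact Or.inr hc
  | false =>
    right
    rw [mem_M2_iff]
    have hc : Conn (endsD ends d) (OneColourSwitch.compl ρ) x y :=
      conn_of_openAdj ⟨e, by simp [OneColourSwitch.compl, he], hends'⟩
    rcases hx with rfl | rfl
    · exact Or.inl hc
    · exact Or.inr hc

omit [Fintype E] [DecidableEq E] in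
/-- Closure of a union of `{r, s}`-components of `G`: an edge of `G` from it to a sided vertex
of `G` ends in it. -/
lemma mem_unionT_of_edge {ρ : Config E} {T : Finset (Finset V)}
    (hT : T ⊆ compsH ends ({r, s} : Set V) ρ) {e : E} {x y : V} (hends : ends e = s(x, y))
    (hx : x ∈ unionT T) (hy : y ∈ A0H ends ({r, s} : Set V) ρ) : y ∈ unionT T := by
  have hcl := closedIn_unionT_H (ends := ends) hT
  rw [sidedH_eq_coe_A0H] at hcl
  exact Finset.mem_coe.1 (hcl e x y hends (Finset.mem_coe.2 hx) (Finset.mem_coe.2 hy))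

omit [Fintype E] [DecidableEq E] in
/-- The union of `{r, s}`-components contains neither `r` nor `s`. -/
lemma ne_rs_of_mem_unionT {ρ : Config E} {T : Finset (Finset V)}
    (hT : T ⊆ compsH ends ({r, s} : Set V) ρ) {x : V} (hx : x ∈ unionT T) : x ≠ r ∧ x ≠ s := by
  have h := mem_A0H.1 (unionT_subset_A0H hT hx)
  simp only [Set.mem_insert_iff, Set.mem_singleton_iff, not_or] at h
  exact h.2

omit [Fintype E] [DecidableEq E] in
/-- **An edge of `G` not at `d` with an endpoint in the world of `G − d` (or at `r`, `s`) touches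
the switched union iff it touches its part inside the world.** -/
lemma touches_iff_of_touches_world (hr : d ≠ r) (hs : d ≠ s) {ρ : Config E}
    {T : Finset (Finset V)} (hT : T ⊆ compsH ends ({r, s} : Set V) ρ) {e : E} (hnd : d ∉ ends e)
    {x y : V} (hends : ends e = s(x, y)) (hx : x = r ∨ x = s ∨ x ∈ A0 (endsD ends d) r s ρ) :
    e ∈ touches ends (↑(unionT T) : Set V) ↔
      e ∈ touches ends (↑(inWorld ends d r s T ρ) : Set V) := by
  constructor
  · rintro ⟨u, hu, v, huv⟩
    have hu' : u ∈ unionT T := Finset.mem_coe.1 hu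
    rw [hends, Sym2.eq_iff] at huv
    rcases huv with ⟨hux, hvy⟩ | ⟨hxv, hyu⟩
    · -- `u = x ∈ unionT T`: `x` is not `r, s`, so it lies in the world of `G − d`
      subst hux
      subst hvy
      have hxrs := ne_rs_of_mem_unionT hT hu'
      have hxW : x ∈ A0 (endsD ends d) r s ρ := by
        rcases hx with h | h | h
        · exact (hxrs.1 h).elim
        · exact (hxrs.2 h).elim
        · exact h
      exact mem_touches_of_ends hends (Or.inl (Finset.mem_coe.2 (mem_inWorld.2 ⟨hu', hxW⟩)))
    · -- `u = y ∈ unionT T`: the other endpoint `x` is `r`, `s` (then `y` is in the world) or a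
      -- world vertex (then `x ∈ unionT T` by closure)
      subst hxv
      subst hyu
      have hyrs := ne_rs_of_mem_unionT hT hu'
      rcases hx with h | h | h
      · have hyW : y ∈ A0 (endsD ends d) r s ρ :=
          mem_A0_endsD_of_edge_rs hr hs hends hnd (Or.inl h) hyrs.1 hyrs.2
        exact mem_touches_of_ends hends (Or.inr (Finset.mem_coe.2 (mem_inWorld.2 ⟨hu', hyW⟩)))
      · have hyW : y ∈ A0 (endsD ends d) r s ρ :=
          mem_A0_endsD_of_edge_rs hr hs hends hnd (Or.inr h) hyrs.1 hyrs.2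
        exact mem_touches_of_ends hends (Or.inr (Finset.mem_coe.2 (mem_inWorld.2 ⟨hu', hyW⟩)))
      · have hxU : x ∈ unionT T :=
          mem_unionT_of_edge hT (by rw [hends, Sym2.eq_swap]) hu' (mem_A0H_of_mem_A0_endsD h)
        exact mem_touches_of_ends hends (Or.inl (Finset.mem_coe.2 (mem_inWorld.2 ⟨hxU, h⟩)))
  · rintro ⟨u, hu, v, huv⟩
    exact ⟨u, Finset.mem_coe.2 (mem_inWorld.1 (Finset.mem_coe.1 hu)).1, v, huv⟩


/-- The part inside the world is a subset of the `Y`-world of `G − d` (for a representative). -/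
lemma inWorld_subset_K2_endsD {ρ : Config E} (hG : ρ ∈ RepH ends p q ({r, s} : Set V))
    {T : Finset (Finset V)} {x : V} (hx : x ∈ inWorld ends d r s T ρ) :
    x ∈ K2 (endsD ends d) r s ρ := by
  obtain ⟨_, hxA⟩ := mem_inWorld.1 hx
  rw [mem_A0] at hxA
  rcases hxA.1 with h | h
  · exact h
  · exfalso
    rcases eq_r_or_s_of_mem_M2_endsD_of_repH (d := d) hG h with h' | h'
    · exact hxA.2.1 h'
    · exact hxA.2.2 h'

omit [Fintype E] [DecidableEq E] in
/-- The part inside the world contains neither `r`, `s` nor `d`. -/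
lemma ne_rsd_of_mem_inWorld (hr : d ≠ r) (hs : d ≠ s) {ρ : Config E} {T : Finset (Finset V)}
    {x : V} (hx : x ∈ inWorld ends d r s T ρ) : x ≠ r ∧ x ≠ s ∧ x ≠ d := by
  obtain ⟨_, hxA⟩ := mem_inWorld.1 hx
  exact ⟨(mem_A0.1 hxA).2.1, (mem_A0.1 hxA).2.2, ne_d_of_mem_A0_endsD hr hs hxA⟩

omit [Fintype E] [DecidableEq E] in
/-- The part inside the world is closed under adjacency inside the sided set of `G − d`. -/
lemma closedIn_inWorld (hr : d ≠ r) (hs : d ≠ s) {ρ : Config E} {T : Finset (Finset V)}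
    (hT : T ⊆ compsH ends ({r, s} : Set V) ρ) :
    ClosedIn (endsD ends d) (sided (endsD ends d) r s ρ) (↑(inWorld ends d r s T ρ) : Set V) := by
  intro e x y hends hx hy
  have hx' := mem_inWorld.1 (Finset.mem_coe.1 hx)
  have hxd : x ≠ d := ne_d_of_mem_A0_endsD hr hs hx'.2
  obtain ⟨hends', _⟩ := ends_eq_of_endsD_eq hxd hends
  have hyA : y ∈ A0 (endsD ends d) r s ρ := mem_A0.2 ⟨hy.1, hy.2.1, hy.2.2⟩
  have hyU : y ∈ unionT T := mem_unionT_of_edge hT hends' hx'.1 (mem_A0H_of_mem_A0_endsD hyA)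
  exact Finset.mem_coe.2 (mem_inWorld.2 ⟨hyU, hyA⟩)

omit [Fintype V] [Fintype E] [DecidableEq E] in
/-- `assignC` unfolded. -/
lemma assignC_eq (T : Finset (Finset V)) (ρ : Config E) :
    assignC ends T ρ = flipTouch ends (↑(unionT T) : Set V) ρ := rfl

/-- The `Y`-world of `G − d` after the switch of `inWorld` in `G − d`: the blocks of
`inWorld` leave it. -/
lemma K2_endsD_flipTouch_inWorld (hr : d ≠ r) (hs : d ≠ s) {ρ : Config E}
    (hG : ρ ∈ RepH ends p q ({r, s} : Set V)) {T : Finset (Finset V)}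
    (hT : T ⊆ compsH ends ({r, s} : Set V) ρ) :
    K2 (endsD ends d) r s (flipTouch (endsD ends d) (↑(inWorld ends d r s T ρ) : Set V) ρ) =
      K2 (endsD ends d) r s ρ \ (↑(inWorld ends d r s T ρ) : Set V) := by
  have hsep : sep2 (endsD ends d) p q r s ρ :=
    sep2_endsD_of_sep2 (sep2_of_sepH (by simp) (by simp) (mem_RepH.1 hG).1)
  rw [K2_flipTouch_of_closed hsep (fun x hx => Or.inl (inWorld_subset_K2_endsD hG hx))
    (fun h => (ne_rsd_of_mem_inWorld hr hs h).1 rfl)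
    (fun h => (ne_rsd_of_mem_inWorld hr hs h).2.1 rfl) (closedIn_inWorld hr hs hT)]
  have h0 : (↑(inWorld ends d r s T ρ) : Set V) ∩ M2 (endsD ends d) r s ρ = ∅ := by
    ext x
    simp only [Set.mem_inter_iff, Set.mem_empty_iff_false, iff_false, not_and]
    intro hx hM
    rcases eq_r_or_s_of_mem_M2_endsD_of_repH (d := d) hG hM with h | h
    · exact (ne_rsd_of_mem_inWorld hr hs hx).1 h
    · exact (ne_rsd_of_mem_inWorld hr hs hx).2.1 h
  rw [h0, Set.union_empty]

/-- The `W`-world of `G − d` after the switch of `inWorld` in `G − d`: the blocks of `inWorld`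
join it. -/
lemma M2_endsD_flipTouch_inWorld (hr : d ≠ r) (hs : d ≠ s) {ρ : Config E}
    (hG : ρ ∈ RepH ends p q ({r, s} : Set V)) {T : Finset (Finset V)}
    (hT : T ⊆ compsH ends ({r, s} : Set V) ρ) :
    M2 (endsD ends d) r s (flipTouch (endsD ends d) (↑(inWorld ends d r s T ρ) : Set V) ρ) =
      M2 (endsD ends d) r s ρ ∪ (↑(inWorld ends d r s T ρ) : Set V) := by
  have hsep : sep2 (endsD ends d) p q r s ρ :=
    sep2_endsD_of_sep2 (sep2_of_sepH (by simp) (by simp) (mem_RepH.1 hG).1)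
  rw [M2_flipTouch_of_closed hsep (fun x hx => Or.inl (inWorld_subset_K2_endsD hG hx))
    (fun h => (ne_rsd_of_mem_inWorld hr hs h).1 rfl)
    (fun h => (ne_rsd_of_mem_inWorld hr hs h).2.1 rfl) (closedIn_inWorld hr hs hT)]
  have h1 : M2 (endsD ends d) r s ρ \ (↑(inWorld ends d r s T ρ) : Set V) =
      M2 (endsD ends d) r s ρ := by
    ext x
    simp only [Set.mem_sdiff, and_iff_left_iff_imp]
    intro hM hx
    rcases eq_r_or_s_of_mem_M2_endsD_of_repH (d := d) hG hM with h | h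
    · exact (ne_rsd_of_mem_inWorld hr hs hx).1 h
    · exact (ne_rsd_of_mem_inWorld hr hs hx).2.1 h
  have h2 : (↑(inWorld ends d r s T ρ) : Set V) ∩ K2 (endsD ends d) r s ρ =
      (↑(inWorld ends d r s T ρ) : Set V) := by
    ext x
    simp only [Set.mem_inter_iff, and_iff_left_iff_imp]
    exact fun hx => inWorld_subset_K2_endsD hG hx
  rw [h1, h2]

omit [Fintype E] [DecidableEq E] in
/-- The switch `assignC T ρ` of `G` and the switch of `inWorld` in `G − d` agree on every edge
of `G − d` with an endpoint in the world of `G − d` (or at `r`, `s`). -/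
lemma assignC_eq_flipTouch_inWorld_on_world (hr : d ≠ r) (hs : d ≠ s) {ρ : Config E}
    {T : Finset (Finset V)} (hT : T ⊆ compsH ends ({r, s} : Set V) ρ) {e : E} {x y : V}
    (hends : endsD ends d e = s(x, y)) (hx : x = r ∨ x = s ∨ x ∈ A0 (endsD ends d) r s ρ) :
    assignC ends T ρ e = flipTouch (endsD ends d) (↑(inWorld ends d r s T ρ) : Set V) ρ e := by
  have hxd : x ≠ d := by
    rcases hx with h | h | h
    · rw [h]; exact fun h' => hr h'.symm
    · rw [h]; exact fun h' => hs h'.symm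
    · exact ne_d_of_mem_A0_endsD hr hs h
  obtain ⟨hends', hnd⟩ := ends_eq_of_endsD_eq hxd hends
  rw [assignC_eq, ← flipTouch_eq_flipTouch_endsD_of_notMem _ _ hnd]
  have key := touches_iff_of_touches_world hr hs hT hnd hends' hx
  by_cases h : e ∈ touches ends (↑(unionT T) : Set V)
  · rw [flipTouch_of_mem ends h, flipTouch_of_mem ends (key.1 h)]
  · rw [flipTouch_of_notMem ends h, flipTouch_of_notMem ends (fun h' => h (key.2 h'))]

/-- The `Y`-world of `G − d` of `assignC T ρ`. -/
lemma K2_endsD_assignC (hr : d ≠ r) (hs : d ≠ s) {ρ : Config E}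
    (hG : ρ ∈ RepH ends p q ({r, s} : Set V)) {T : Finset (Finset V)}
    (hT : T ⊆ compsH ends ({r, s} : Set V) ρ) :
    K2 (endsD ends d) r s (assignC ends T ρ) =
      K2 (endsD ends d) r s ρ \ (↑(inWorld ends d r s T ρ) : Set V) := by
  rw [← K2_endsD_flipTouch_inWorld hr hs hG hT]
  apply expl_eq_of_eqOn_touches
  rintro e ⟨x, hx, y, hends⟩
  have hx2 : x ∈ K2 (endsD ends d) r s
      (flipTouch (endsD ends d) (↑(inWorld ends d r s T ρ) : Set V) ρ) := hx
  rw [K2_endsD_flipTouch_inWorld hr hs hG hT] at hx2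
  have hxK : x ∈ K2 (endsD ends d) r s ρ := hx2.1
  have hx' : x = r ∨ x = s ∨ x ∈ A0 (endsD ends d) r s ρ := by
    by_cases hxr : x = r
    · exact Or.inl hxr
    by_cases hxs : x = s
    · exact Or.inr (Or.inl hxs)
    exact Or.inr (Or.inr (mem_A0.2 ⟨Or.inl hxK, hxr, hxs⟩))
  exact (assignC_eq_flipTouch_inWorld_on_world hr hs hT hends hx').symm

/-- The `W`-world of `G − d` of `assignC T ρ`. -/
lemma M2_endsD_assignC (hr : d ≠ r) (hs : d ≠ s) {ρ : Config E}
    (hG : ρ ∈ RepH ends p q ({r, s} : Set V)) {T : Finset (Finset V)}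
    (hT : T ⊆ compsH ends ({r, s} : Set V) ρ) :
    M2 (endsD ends d) r s (assignC ends T ρ) =
      M2 (endsD ends d) r s ρ ∪ (↑(inWorld ends d r s T ρ) : Set V) := by
  rw [← M2_endsD_flipTouch_inWorld hr hs hG hT]
  -- `M2 ω = expl (compl ω)`: compare the complements edgewise
  show expl (endsD ends d) ({r, s} : Set V) (OneColourSwitch.compl (assignC ends T ρ)) =
    expl (endsD ends d) ({r, s} : Set V)
      (OneColourSwitch.compl (flipTouch (endsD ends d) (↑(inWorld ends d r s T ρ) : Set V) ρ))
  apply expl_eq_of_eqOn_touches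
  rintro e ⟨x, hx, y, hends⟩
  have hx' : x ∈ M2 (endsD ends d) r s
      (flipTouch (endsD ends d) (↑(inWorld ends d r s T ρ) : Set V) ρ) := hx
  rw [M2_endsD_flipTouch_inWorld hr hs hG hT] at hx'
  have hx'' : x = r ∨ x = s ∨ x ∈ A0 (endsD ends d) r s ρ := by
    rcases hx' with hM | hI
    · rcases eq_r_or_s_of_mem_M2_endsD_of_repH (d := d) hG hM with h | h
      · exact Or.inl h
      · exact Or.inr (Or.inl h)
    · exact Or.inr (Or.inr (mem_inWorld.1 (Finset.mem_coe.1 hI)).2)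
  have := assignC_eq_flipTouch_inWorld_on_world hr hs hT hends hx''
  simp only [OneColourSwitch.compl]
  rw [this]

end Switch

end NoPocket

end Summit.Ventures.PercRepro2
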